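/-
Copyright (c) 2026 the pub-hodgecm-mathlib formalisation cell (harness21).  Prover seat hodgecm-mathlib-LH4-p13 (g8), req620 Track A «(D-RAM) FOUR-FRAME» squad, tier 0,
STAGE-1b PRE-SCOPING (heir LEAD F0P3a-plan (g20) T19-24∕T19-31 (R-29)(b); dealer LH4-plan (g12) WORD #45∕#50 «(α) ↦ p13»): organ (L-lab) «THE LABEL LAW» — brick (L-lab-12)
«THE LABEL READ ON AN HNF LATTICE»: on `latt[[1,0,0],[x,p,0],[y,z,r]]` the two-slot model value `C₀N(w₀) + C₁N(w₁)` is, modulo `C₁·p`, the ONE-slot value `(C₀ + C₁N(x))·N(w₀)` —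
so once `|C₁·p| ≤ |ϖ^m|` the model label is the norm class of `C₀ + C₁·N(x)`, a function of the GLUE UNIT `x` (PRESCOPE (L-lab) v3 §2 (b) as a theorem).  2026-09-04.
-/
import Summits.HodgeConjecture.HodgeConjecture.Theorems.F0P3cDyRamModelOneSlotLabel          -- ★ p859368 (this seat, (L-lab-11)): `apply_zero_eq_pairing_single_two`, brings ★ (L-lab-1) `setOf_slot_eq_valueSetMod_smul_xPlus`, ★ №3 Pieces
import Summits.HodgeConjecture.HodgeConjecture.Theorems.F0P3cDyRamDiagonalStableLatticeHNF   -- ★ (LH4-p12 (g2)): `mem_latt_hnf_iff`, `mulVec_hnf`; brings ★ `mulVec_mem_latt`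
import HarnessLib

/-!
# Crux `H413`, line LH4 «(D-RAM) FOUR-FRAME», tier 0, STAGE-1b pre-scoping — (L-lab-12) «THE LABEL READ ON AN HNF LATTICE»: the two-slot model value on
# `V·𝒪³`, `V = [[1,0,0],[x,p,0],[y,z,r]]`, collapses to the one-slot value `(C₀ + C₁·N(x))·N(w₀)` modulo `C₁·p`; the label is the norm class of `C₀ + C₁·N(x)`

Cell `hodgecm-mathlib` (D-0151), FLOOR 0, crux item H413 = `stmt-HodgeConjecture-24833`, route of record `HCCMUnconditional`; squad F0∕P3c∕LH4.  SCOPING INVENTORY for the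
STAGE-1b directive ((α₁)∕(β₁) stratum by stratum; PRESCOPE (L-lab) v3 f0ecf9c5 §2–§3 hand (H2) «the label read on the eight shapes», in LH4-p09 (g8)'s ★ `LevelTokenHNF` ∕
`LabelledSplitStrata` ∕ `LabelledGluedStratumRead` currency: the strata are HNF lattices `latt V`).  THEOREMS ONLY (no `def`, no instance, no notation, no `sorry`, default heartbeats),
★-only imports, lane `--supports stmt-HodgeConjecture-24833 --as helper`; pays NO row, states NO law.

THE MATHEMATICS.  `M = latt V`, `V = [[1,0,0],[x,p,0],[y,z,r]]` with `|x| ≤ 1`, `|p| ≤ 1` (every Stage-B normal form: split T3 `(x, ϖ^s)`, glued G1 `(x, ϖ^ρ; xζ+y″, ϖ^ρζ, ϖ^{2ρ+s})`, …).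
A vector of `M` is `w = V u = (u₀, x u₀ + p u₁, …)`, `u` integral (★ `mulVec_hnf`, ★ `mem_latt_hnf_iff`), so for the reading-1 model value of ★ p859223 (slots 0 and 1; `σ` isometric)
  `C₀·N(w₀) + C₁·N(w₁) = (C₀ + C₁·N(x))·N(u₀) + C₁·(σ(x u₀)·p u₁ + x u₀·σ(p u₁) + N(p u₁))`,
and the bracket has valuation `≥ |C₁·p|`.  Hence (§2) **if `|(ϖ^m)⁻¹·C₁·p| ≤ 1` the `ϖ^m`-thickened value set of `C₀N(w₀) + C₁N(w₁)` on `M` equals that of the ONE-slot value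
`(C₀ + C₁N(x))·N(w₀)`**, and since the slot-0 image of `M` is exactly `𝒪` (§1) ★ (L-lab-1) turns it into `valueSetMod σ ϖ m (e • X₊)` for every `e` with `e·t₊ = C₀ + C₁·N(x)` (§3):
**the model label on `latt V` is the norm class of `C₀ + C₁·N(x)`** (★ (L-lab-3)).  Two regimes: `|C₁| ≤ |ϖ^m|` — the whole second slot is negligible, the class is that of `C₀`,
CONSTANT on the stratum (PRESCOPE §2 (a)); `|C₁·p| ≤ |ϖ^m| < |C₁|` — the class of `C₀ + C₁N(x)` genuinely depends on the glue unit `x`: the label VARIES across the stratum and the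
labelled stratum census is `#{x : ω((C₀ + C₁N(x))∕…) = +}` (§2 (b), the «equidistribution per stratum» count).  The same read applies verbatim to the other two readings of ★ p859340
(slots `(0,2)`: column `y`; slots `(1,2)`: after the permutation ★ `LabelledStrataPermutation`).

* §1 `apply_zero_of_mem_latt_hnf` ∕ `exists_mem_latt_hnf_apply_zero_eq` (the slot-0 image of `latt V` is `𝒪`), `norm_add_sub_norm` (`N(a + b) − N(a) = aσb + σa·b + N(b)`),
  `v_sub_oneSlot_le` (`|C₁·(N(w₁) − N(x)·N(w₀))| ≤ |C₁·p|` on `latt V`), `image_apply_zero_latt_hnf_iff`.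
* §2 **`setOf_value_latt_hnf_eq_setOf_oneSlot`** (the collapse modulo `C₁·p`).
* §3 HEADS **`setOf_value_latt_hnf_eq_valueSetMod_smul_xPlus`** (`= valueSetMod σ ϖ m (e • X₊)` for `e·t₊ = C₀ + C₁N(x)`), **`modelLabel_latt_hnf_iff_labelPlus_smul`** (the label `+`
  of the model set ⟺ `LabelPlus σ ϖ d m (e • xPlus σ ϖ d)`) and `modelLabel_latt_hnf_iff_of_smul` (any reference class `c • X₊`).
HONEST LABEL.  Count-neutral scoping brick; the three tier-0 rows stay OPEN; `HC_CM` is proved only modulo the 7 printed citations (2 remaining named inputs: hLiu418 =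
`stmt-HodgeConjecture-24832`, h413 = `stmt-HodgeConjecture-24833`) until rung 0 closes.

## References
* [Serre1980Trees] J.-P. Serre, *Trees*, Springer (1980), Ch. II §1.1 (lattices and Hermite normal forms).
* [Kottwitz1986BaseChangeUnits] R. E. Kottwitz, *Base change for unit elements of Hecke algebras*, Compositio Math. 60 (1986), §1 pp. 240–241 (lattice counts modulo the torus).
* [Rogawski1990] J. D. Rogawski, *Automorphic Representations of Unitary Groups in Three Variables*, Ann. of Math. Stud. 123 (1990), §4.9 Prop. 4.9.1 (b) p. 55.
* [Serre1979] J.-P. Serre, *Local Fields*, GTM 67 (1979), Ch. V §3 Cor. 3 (norm classes of units).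
-/

set_option autoImplicit false

noncomputable section

namespace Summit.HodgeConjecture.HodgeConjecture.Cruxes.H413.F0P3cDyRamHNFLatticeLabelRead

open Literature.NumberTheory.Automorphic Literature.NumberTheory.Automorphic.HermitianLattice
open Literature.NumberTheory.Automorphic.UnitaryLatticeTree Literature.NumberTheory.Automorphic.UnitaryThreeFourFrame
open Summit.HodgeConjecture.HodgeConjecture.Cruxes.H413.F0P3cDyRamFourFramePieces
open Summit.HodgeConjecture.HodgeConjecture.Cruxes.H413.F0P3cDyRamFourFrameCensusDefs
open Summit.HodgeConjecture.HodgeConjecture.Cruxes.H413.F0P3cDyRamDiagonalStableLatticeHNF (mem_latt_hnf_iff mulVec_hnf)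
open Summit.HodgeConjecture.HodgeConjecture.Cruxes.H413.F0P3cDyRamFrameEltOneSlotLabel (setOf_slot_eq_valueSetMod_smul_xPlus)
open Summit.HodgeConjecture.HodgeConjecture.Cruxes.H413.F0P3cDyRamModelOneSlotLabel (apply_zero_eq_pairing_single_two)
open scoped Matrix MatrixGroups Valued WithZero

variable {K : Type} [Field K] [Valued K ℤᵐ⁰]

/-! ## §1  The slot-0 image of `latt V` is `𝒪`; the second slot differs from `N(x)·N(w₀)` by `C₁·p` at most -/

/-- On `latt[[1,0,0],[x,p,0],[y,z,r]]` (`p, r ≠ 0`) the slot-0 coordinate is integral. [cite: Serre1980Trees, Ch. II §1.1] -/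
theorem apply_zero_of_mem_latt_hnf (x y z : K) {p r : K} (hp : p ≠ 0) (hr : r ≠ 0) {w : Fin 3 → K}
    (hw : w ∈ latt (Matrix.of ![![1, 0, 0], ![x, p, 0], ![y, z, r]])) : Valued.v (w 0) ≤ 1 :=
  ((mem_latt_hnf_iff x y z hp hr w).1 hw).1

/-- Conversely every integral `t` is the slot-0 coordinate of `V·(t, 0, 0) ∈ latt V`. [cite: Serre1980Trees, Ch. II §1.1] -/
theorem exists_mem_latt_hnf_apply_zero_eq (x y z p r : K) {t : K} (ht : Valued.v t ≤ 1) :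
    ∃ w ∈ latt (Matrix.of ![![1, 0, 0], ![x, p, 0], ![y, z, r]]), w 0 = t := by
  refine ⟨(Matrix.of ![![1, 0, 0], ![x, p, 0], ![y, z, r]]) *ᵥ ![t, 0, 0], mulVec_mem_latt _ ((mem_stdLattice).2 fun i => ?_), ?_⟩
  · fin_cases i
    · simpa using ht
    · simp
    · simp
  · rw [mulVec_hnf]; rfl

/-- The slot-0 image of `latt V` is the principal module `1·𝒪` (the `hgen` of ★ (L-lab-1) with `s⋆ = 1`). [cite: Serre1980Trees, Ch. II §1.1] -/
theorem image_apply_zero_latt_hnf_iff (σ : K →+* K) (x y z : K) {p r : K} (hp : p ≠ 0) (hr : r ≠ 0) (t : K) :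
    (∃ w ∈ latt (Matrix.of ![![1, 0, 0], ![x, p, 0], ![y, z, r]]), pairing σ ((StdForm.antidiagonal 3).over K) (Pi.single 2 1) w = t) ↔
      ∃ s : K, Valued.v s ≤ 1 ∧ t = 1 * s := by
  simp only [← apply_zero_eq_pairing_single_two, one_mul]
  constructor
  · rintro ⟨w, hw, rfl⟩
    exact ⟨w 0, apply_zero_of_mem_latt_hnf x y z hp hr hw, rfl⟩
  · rintro ⟨s, hs, rfl⟩
    exact exists_mem_latt_hnf_apply_zero_eq x y z p r hs

omit [Valued K ℤᵐ⁰] in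
/-- `N(a + b) − N(a) = a·σb + σa·b + b·σb` (`N(c) = c·σc`). [cite: Serre1979, Ch. V §3 Cor. 3] -/
theorem norm_add_sub_norm (σ : K →+* K) (a b : K) : (a + b) * σ (a + b) - a * σ a = a * σ b + σ a * b + b * σ b := by
  rw [map_add]; ring

/-- **THE SECOND SLOT DIFFERS FROM `N(x)·N(w₀)` BY `C₁·p`**: for `w ∈ latt V` (`|x| ≤ 1`, `|p| ≤ 1`, `σ` isometric),
`|(ϖ^m)⁻¹·(C₁·N(w₁) − C₁·N(x)·N(w₀))| ≤ |(ϖ^m)⁻¹·C₁·p|` — since `w₁ = x w₀ + p u₁` with `u₁` integral. [cite: Serre1980Trees, Ch. II §1.1] [cite: Kottwitz1986BaseChangeUnits, §1 pp. 240–241] -/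
theorem v_sub_oneSlot_le {σ : K →+* K} (hvσ : ∀ a, Valued.v (σ a) = Valued.v a) (ϖ : K) (m : ℕ) {x p : K} (hx : Valued.v x ≤ 1) (hp1 : Valued.v p ≤ 1) (hp : p ≠ 0)
    (y z : K) {r : K} (hr : r ≠ 0) (C₁ : K) {w : Fin 3 → K} (hw : w ∈ latt (Matrix.of ![![1, 0, 0], ![x, p, 0], ![y, z, r]])) :
    Valued.v ((ϖ ^ m)⁻¹ * (C₁ * (w 1 * σ (w 1)) - C₁ * (x * σ x) * (w 0 * σ (w 0)))) ≤ Valued.v ((ϖ ^ m)⁻¹ * (C₁ * p)) := by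
  obtain ⟨hw0, hw1, -⟩ := (mem_latt_hnf_iff x y z hp hr w).1 hw
  -- `b := w₁ − x w₀`, `|b| ≤ |p|`
  have hfac : C₁ * (w 1 * σ (w 1)) - C₁ * (x * σ x) * (w 0 * σ (w 0)) =
      C₁ * ((x * w 0) * σ (w 1 - x * w 0) + σ (x * w 0) * (w 1 - x * w 0) + (w 1 - x * w 0) * σ (w 1 - x * w 0)) := by
    have h := norm_add_sub_norm σ (x * w 0) (w 1 - x * w 0)
    rw [add_sub_cancel] at h
    rw [← h, map_mul]; ring
  have hxw : Valued.v (x * w 0) ≤ 1 := by rw [map_mul]; exact mul_le_one' hx hw0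
  have hb : Valued.v (w 1 - x * w 0) ≤ Valued.v p := hw1
  have h3 : Valued.v ((x * w 0) * σ (w 1 - x * w 0) + σ (x * w 0) * (w 1 - x * w 0) + (w 1 - x * w 0) * σ (w 1 - x * w 0)) ≤ Valued.v p := by
    refine Valuation.map_add_le _ (Valuation.map_add_le _ ?_ ?_) ?_
    · rw [map_mul, hvσ]; exact mul_le_of_le_one_of_le hxw hb
    · rw [map_mul, hvσ]; exact mul_le_of_le_one_of_le hxw hb
    · rw [map_mul, hvσ]
      calc Valued.v (w 1 - x * w 0) * Valued.v (w 1 - x * w 0) ≤ Valued.v p * Valued.v p := mul_le_mul' hb hb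
        _ ≤ Valued.v p * 1 := mul_le_mul' le_rfl hp1
        _ = Valued.v p := mul_one _
  have hR : Valued.v ((ϖ ^ m)⁻¹ * (C₁ * p)) = Valued.v ((ϖ ^ m)⁻¹ * C₁) * Valued.v p := by rw [← mul_assoc, map_mul]
  rw [hfac, ← mul_assoc, map_mul, hR]
  exact mul_le_mul' le_rfl h3

/-! ## §2  The collapse: modulo `C₁·p` the two-slot value is the one-slot value `(C₀ + C₁N(x))·N(w₀)` -/

/-- **COLLAPSE TO ONE SLOT.**  On `latt[[1,0,0],[x,p,0],[y,z,r]]` (`|x| ≤ 1`, `|p| ≤ 1`, `p, r ≠ 0`, `σ` isometric), if `|(ϖ^m)⁻¹·C₁·p| ≤ 1` then the `ϖ^m`-thickened value set of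
`C₀·N(w₀) + C₁·N(w₁)` equals that of `(C₀ + C₁·N(x))·N(w₀)`. [cite: Kottwitz1986BaseChangeUnits, §1 pp. 240–241] [cite: Serre1980Trees, Ch. II §1.1] -/
theorem setOf_value_latt_hnf_eq_setOf_oneSlot {σ : K →+* K} (hvσ : ∀ a, Valued.v (σ a) = Valued.v a) (ϖ : K) (m : ℕ) {x p : K} (hx : Valued.v x ≤ 1)
    (hp1 : Valued.v p ≤ 1) (hp : p ≠ 0) (y z : K) {r : K} (hr : r ≠ 0) (C₀ C₁ : K) (hC : Valued.v ((ϖ ^ m)⁻¹ * (C₁ * p)) ≤ 1) :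
    {v | ∃ w ∈ latt (Matrix.of ![![1, 0, 0], ![x, p, 0], ![y, z, r]]),
        Valued.v ((ϖ ^ m)⁻¹ * (v - (C₀ * (w 0 * σ (w 0)) + C₁ * (w 1 * σ (w 1))))) ≤ 1} =
      {v | ∃ w ∈ latt (Matrix.of ![![1, 0, 0], ![x, p, 0], ![y, z, r]]),
        Valued.v ((ϖ ^ m)⁻¹ * (v - (C₀ + C₁ * (x * σ x)) * (w 0 * σ (w 0)))) ≤ 1} := by
  have hsmall : ∀ w ∈ latt (Matrix.of ![![1, 0, 0], ![x, p, 0], ![y, z, r]]),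
      Valued.v ((ϖ ^ m)⁻¹ * (C₁ * (w 1 * σ (w 1)) - C₁ * (x * σ x) * (w 0 * σ (w 0)))) ≤ 1 :=
    fun w hw => (v_sub_oneSlot_le hvσ ϖ m hx hp1 hp y z hr C₁ hw).trans hC
  ext v
  simp only [Set.mem_setOf_eq]
  constructor
  · rintro ⟨w, hw, hv⟩
    refine ⟨w, hw, ?_⟩
    have key := Valuation.map_add_le _ hv (hsmall w hw)
    convert key using 2
    ring
  · rintro ⟨w, hw, hv⟩
    refine ⟨w, hw, ?_⟩
    have key := Valuation.map_sub_le _ hv (hsmall w hw)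
    convert key using 2
    ring

/-! ## §3  Heads: the model label on `latt V` is the norm class of `C₀ + C₁·N(x)` -/

/-- **THE LABEL READ ON AN HNF LATTICE.**  Under the hypotheses of §2, for every `e` with `e·t₊ = C₀ + C₁·N(x)`:
`{C₀N(w₀) + C₁N(w₁) | w ∈ latt V} + ϖ^m𝒪 = valueSetMod σ ϖ m (e • xPlus σ ϖ d)` — the two-slot model value set is the value set of ONE scalar multiple of `X₊`, with scalar class
that of `C₀ + C₁N(x)`: constant in `x` when `|C₁| ≤ |ϖ^m|`, a function of the glue unit `x` otherwise. [cite: Rogawski1990, §4.9 Prop. 4.9.1 (b) p. 55] [cite: Kottwitz1986BaseChangeUnits, §1 pp. 240–241] -/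
theorem setOf_value_latt_hnf_eq_valueSetMod_smul_xPlus {σ : K →+* K} (hvσ : ∀ a, Valued.v (σ a) = Valued.v a) (ϖ : K) (d m : ℕ) {x p : K} (hx : Valued.v x ≤ 1)
    (hp1 : Valued.v p ≤ 1) (hp : p ≠ 0) (y z : K) {r : K} (hr : r ≠ 0) (C₀ C₁ : K) (hC : Valued.v ((ϖ ^ m)⁻¹ * (C₁ * p)) ≤ 1)
    {e : K} (he : e * ((ϖ - σ ϖ) * ((ϖ * σ ϖ) ^ ((d - d % 2) / 2))⁻¹) = C₀ + C₁ * (x * σ x)) :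
    {v | ∃ w ∈ latt (Matrix.of ![![1, 0, 0], ![x, p, 0], ![y, z, r]]),
        Valued.v ((ϖ ^ m)⁻¹ * (v - (C₀ * (w 0 * σ (w 0)) + C₁ * (w 1 * σ (w 1))))) ≤ 1} =
      valueSetMod σ ϖ m (e • xPlus σ ϖ d) := by
  rw [setOf_value_latt_hnf_eq_setOf_oneSlot hvσ ϖ m hx hp1 hp y z hr C₀ C₁ hC]
  have he' : e * ((ϖ - σ ϖ) * ((ϖ * σ ϖ) ^ ((d - d % 2) / 2))⁻¹) = (C₀ + C₁ * (x * σ x)) * (1 * σ 1) := by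
    rw [he, map_one, mul_one, mul_one]
  have h := setOf_slot_eq_valueSetMod_smul_xPlus σ ϖ d m (latt (Matrix.of ![![1, 0, 0], ![x, p, 0], ![y, z, r]])) (Pi.single 2 1)
    (C₀ + C₁ * (x * σ x)) 1 e (image_apply_zero_latt_hnf_iff σ x y z hp hr) he'
  simp only [← apply_zero_eq_pairing_single_two] at h
  exact h

/-- **THE MODEL LABEL ON `latt V` VERSUS ANY REFERENCE CLASS**: `{C₀N(w₀) + C₁N(w₁)}~ = valueSetMod σ ϖ m (c • X₊) ↔ valueSetMod σ ϖ m (e • X₊) = valueSetMod σ ϖ m (c • X₊)` for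
`e·t₊ = C₀ + C₁N(x)` (`c = 1`: label `+`; `c` a non-norm unit: «LabelMinus′»). [cite: Rogawski1990, §4.9 Prop. 4.9.1 (b) p. 55] [cite: Serre1979, Ch. V §3 Cor. 3] -/
theorem modelLabel_latt_hnf_iff_of_smul {σ : K →+* K} (hvσ : ∀ a, Valued.v (σ a) = Valued.v a) (ϖ : K) (d m : ℕ) {x p : K} (hx : Valued.v x ≤ 1)
    (hp1 : Valued.v p ≤ 1) (hp : p ≠ 0) (y z : K) {r : K} (hr : r ≠ 0) (C₀ C₁ : K) (hC : Valued.v ((ϖ ^ m)⁻¹ * (C₁ * p)) ≤ 1)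
    {e : K} (he : e * ((ϖ - σ ϖ) * ((ϖ * σ ϖ) ^ ((d - d % 2) / 2))⁻¹) = C₀ + C₁ * (x * σ x)) (c : K) :
    ({v | ∃ w ∈ latt (Matrix.of ![![1, 0, 0], ![x, p, 0], ![y, z, r]]),
        Valued.v ((ϖ ^ m)⁻¹ * (v - (C₀ * (w 0 * σ (w 0)) + C₁ * (w 1 * σ (w 1))))) ≤ 1} = valueSetMod σ ϖ m (c • xPlus σ ϖ d)) ↔
      valueSetMod σ ϖ m (e • xPlus σ ϖ d) = valueSetMod σ ϖ m (c • xPlus σ ϖ d) := by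
  rw [setOf_value_latt_hnf_eq_valueSetMod_smul_xPlus hvσ ϖ d m hx hp1 hp y z hr C₀ C₁ hC he]

/-- **THE MODEL LABEL `+` ON `latt V` IS `LabelPlus σ ϖ d m (e • X₊)`**, `e·t₊ = C₀ + C₁·N(x)` — decided by ★ (L-lab-3) `labelPlus_smul_xPlus_iff_exists_norm(_of_congr)`: the norm class of
`C₀ + C₁·N(x)`. [cite: Rogawski1990, §4.9 Prop. 4.9.1 (b) p. 55] [cite: Serre1979, Ch. V §3 Cor. 3] -/
theorem modelLabel_latt_hnf_iff_labelPlus_smul {σ : K →+* K} (hvσ : ∀ a, Valued.v (σ a) = Valued.v a) (ϖ : K) (d m : ℕ) {x p : K} (hx : Valued.v x ≤ 1)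
    (hp1 : Valued.v p ≤ 1) (hp : p ≠ 0) (y z : K) {r : K} (hr : r ≠ 0) (C₀ C₁ : K) (hC : Valued.v ((ϖ ^ m)⁻¹ * (C₁ * p)) ≤ 1)
    {e : K} (he : e * ((ϖ - σ ϖ) * ((ϖ * σ ϖ) ^ ((d - d % 2) / 2))⁻¹) = C₀ + C₁ * (x * σ x)) :
    ({v | ∃ w ∈ latt (Matrix.of ![![1, 0, 0], ![x, p, 0], ![y, z, r]]),
        Valued.v ((ϖ ^ m)⁻¹ * (v - (C₀ * (w 0 * σ (w 0)) + C₁ * (w 1 * σ (w 1))))) ≤ 1} = valueSetMod σ ϖ m (xPlus σ ϖ d)) ↔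
      LabelPlus σ ϖ d m (e • xPlus σ ϖ d) := by
  have h := modelLabel_latt_hnf_iff_of_smul hvσ ϖ d m hx hp1 hp y z hr C₀ C₁ hC he 1
  rw [one_smul] at h
  rw [h, LabelPlus]

end Summit.HodgeConjecture.HodgeConjecture.Cruxes.H413.F0P3cDyRamHNFLatticeLabelRead

end
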